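import Summits.NavierStokesRegularity.FunctionalMining.GradPressureMomentRate
import Summits.NavierStokesRegularity.FunctionalMining.C1WeightIntegralVec
import Mathlib.Analysis.InnerProductSpace.NormPow
import HarnessLib

/-!
# FunctionalMining — `∫|∇p|^q` at every real `q > 1`: the exact rate along classical solutions

Search for candidate a priori estimates; no regularity claim. Cell `pub-nsfunc`, prove seat
(gen 11). K0 family `EP.gradp.q` (rows `EP.gradp.q=3/2`, `EP.gradp.q=2`): for the pressure-gradient
moment `torusGradPressureMoment q v = ∫ ‖∇π_v‖^q` (`GradPressureMomentRate`) and every REAL `q > 1`,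
along every classical unforced solution on `T^d × [a, b]`,

`d/dt ∫‖∇π‖^q = ∫ q‖∇π‖^{q−2} ⟪∇π, ∇∂ₜπ⟫ = N_q + ν V_q`,
`V_q(v) = ∫ q‖∇π_v‖^{q−2} ⟪∇π_v, ∇Δ⁻¹A_v⟫`, `N_q(v) = ∫ q‖∇π_v‖^{q−2} ⟪∇π_v, ∇Δ⁻¹B_v⟫`

(`∂ₜπ = Δ⁻¹(νA_v + B_v)`, `A_v = pressureSqViscousSource`, `B_v = pressureSqInertialSource`,
`PressureMomentRateRpow.timeDerivWithin_neg_gradSqTrace`). The weight `w ↦ ‖w‖^q` on `ℝ^d` is only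
`C¹` (Mathlib `contDiff_norm_rpow`, derivative `q‖w‖^{q−2}⟪w, ·⟫`, `= 0` at `w = 0`), so the time
derivative is taken with the vector-valued `C¹`-weight tool
`C1Weight.hasDerivWithinAt_integral_comp_fderiv` (`C1WeightIntegralVec`) applied to the jointly
smooth field `(s, x) ↦ ∇π(s, x)`. Packaged as `HasInitialRate (torusGradPressureMoment q) N_q V_q`
for the heat sieve (`HeatSieve`). Identities along smooth solutions only.
-/

noncomputable section

open MeasureTheory Finset Set Filter Topology
open scoped InnerProductSpace RealInnerProductSpace ContDiff

namespace Summit.NavierStokesRegularity.FunctionalMining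

open Literature.Analysis.FunctionSpaces Literature.Analysis.FluidPDE

variable {d : Type*} [Fintype d] [DecidableEq d]

/-! ## 1. The rates -/

/-- **Viscous (heat-flow) rate of `∫‖∇π‖^q`**: `V_q(v) = ∫ q‖∇π_v‖^{q−2} ⟪∇π_v, ∇Δ⁻¹A_v⟫`.
[ours; bookkeeping] -/
def gradPressureRpowViscousRate (q : ℝ) (v : UnitAddTorus d → EuclideanSpace ℝ d) : ℝ :=
  ∫ x, q * ‖Torus.gradient (pressureOf v) x‖ ^ (q - 2) *
    ⟪Torus.gradient (pressureOf v) x,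
      Torus.gradient (Torus.invLaplacian (pressureSqViscousSource v)) x⟫_ℝ

/-- **Inertial rate of `∫‖∇π‖^q`**: `N_q(v) = ∫ q‖∇π_v‖^{q−2} ⟪∇π_v, ∇Δ⁻¹B_v⟫`. [ours; bookkeeping] -/
def gradPressureRpowInertialRate (q : ℝ) (v : UnitAddTorus d → EuclideanSpace ℝ d) : ℝ :=
  ∫ x, q * ‖Torus.gradient (pressureOf v) x‖ ^ (q - 2) *
    ⟪Torus.gradient (pressureOf v) x,
      Torus.gradient (Torus.invLaplacian (pressureSqInertialSource v)) x⟫_ℝ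

/-! ## 2. Calculus of the weight and of gradients -/

/-- `D(‖·‖^q)(w)[z] = q‖w‖^{q−2}⟪w, z⟫` for `q > 1` (Mathlib `fderiv_norm_rpow`). [folklore] -/
theorem fderiv_norm_rpow_apply' {E : Type*} [NormedAddCommGroup E] [InnerProductSpace ℝ E]
    {q : ℝ} (hq : 1 < q) (w z : E) :
    fderiv ℝ (fun y : E => ‖y‖ ^ q) w z = q * ‖w‖ ^ (q - 2) * ⟪w, z⟫_ℝ := by
  rw [fderiv_norm_rpow w hq, _root_.smul_apply, innerSL_apply_apply, smul_eq_mul,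
    mul_assoc]

/-- Linearity of the torus gradient in coordinates: `∇(c • f + g) = c • ∇f + ∇g` for `C¹` `f, g`.
[folklore] -/
theorem gradient_const_smul_add {f g : UnitAddTorus d → ℝ} (hf : Torus.IsContDiff 1 f)
    (hg : Torus.IsContDiff 1 g) (c : ℝ) (x : UnitAddTorus d) :
    Torus.gradient (c • f + g) x = c • Torus.gradient f x + Torus.gradient g x := by
  have hcf : Torus.IsContDiff 1 (c • f) := hf.smul c
  rw [Torus.gradient_eq_sum_partialDeriv (hcf.add hg), Torus.gradient_eq_sum_partialDeriv hf,
    Torus.gradient_eq_sum_partialDeriv hg, Finset.smul_sum, ← Finset.sum_add_distrib]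
  refine Finset.sum_congr rfl fun i _ => ?_
  rw [Torus.partialDeriv_add hcf hg, Torus.partialDeriv_const_smul hf]
  simp only [Pi.add_apply, Pi.smul_apply, smul_eq_mul]
  rw [add_smul, mul_smul]

/-! ## 3. The exact rate -/

/-- **`d/dt ∫‖∇π‖^q = N_q + νV_q` along classical unforced solutions on `T^d`, real `q > 1`.**
[ours] -/
theorem hasDerivWithinAt_torusGradPressureMoment_rpow [Nonempty d] {q : ℝ} (hq : 1 < q)
    {a b ν : ℝ} {u : ℝ → UnitAddTorus d → EuclideanSpace ℝ d} {p : ℝ → UnitAddTorus d → ℝ}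
    (h : Torus.IsClassicalNSSolutionOn (Icc a b) ν 0 u p) (hab : a < b) {t : ℝ} (ht : t ∈ Icc a b) :
    HasDerivWithinAt (fun s => torusGradPressureMoment q (u s))
      (gradPressureRpowInertialRate q (u t) + ν * gradPressureRpowViscousRate q (u t)) (Icc a b) t := by
  have hU : UniqueDiffOn ℝ (Icc a b) := uniqueDiffOn_Icc hab
  have hint : (interior (Icc a b)).Nonempty := by
    rw [interior_Icc]; exact nonempty_Ioo.2 hab
  have hu : Torus.IsSmoothSpaceTimeOn (Icc a b) u := h.smooth_velocity
  have hus : ∀ s ∈ Icc a b, Torus.IsSmooth (u s) := fun s hs => hu.isSmooth_slice hs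
  have hut : Torus.IsSmooth (u t) := hus t ht
  have hσ : Torus.IsSmoothSpaceTimeOn (Icc a b) (fun s x => -gradSqTrace (u s) x) := by
    have h1 : Torus.IsSmoothSpaceTimeOn (Icc a b) (fun s x => gradSqTrace (u s) x) :=
      Torus.IsSmoothSpaceTimeOn.sum fun i _ => Torus.IsSmoothSpaceTimeOn.sum fun j _ =>
        ((hu.partialDeriv hU i).apply j).mul ((hu.partialDeriv hU j).apply i)
    exact h1.neg
  have hP : Torus.IsSmoothSpaceTimeOn (Icc a b) (fun s => pressureOf (u s)) :=
    hσ.invLaplacian (convex_Icc a b) hint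
  have hθ : Torus.IsSmoothSpaceTimeOn (Icc a b) (fun s => Torus.gradient (pressureOf (u s))) :=
    hP.gradient hU
  have hπs : ∀ s ∈ Icc a b, Torus.IsSmooth (pressureOf (u s)) := fun s hs => isSmooth_pressureOf (hus s hs)
  have hπ : Torus.IsSmooth (pressureOf (u t)) := hπs t ht
  -- `W = ∂ₜπ = Δ⁻¹(νA + B)`
  set W : UnitAddTorus d → ℝ := Torus.timeDerivWithin (Icc a b) (fun s => pressureOf (u s)) t with hW
  have hWs : Torus.IsSmooth W := hP.isSmooth_timeDerivWithin hU ht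
  have hA : Torus.IsSmooth (pressureSqViscousSource (u t)) := isSmooth_pressureSqViscousSource hut
  have hB : Torus.IsSmooth (pressureSqInertialSource (u t)) := isSmooth_pressureSqInertialSource hut
  set GA : UnitAddTorus d → ℝ := Torus.invLaplacian (pressureSqViscousSource (u t)) with hGA
  set GB : UnitAddTorus d → ℝ := Torus.invLaplacian (pressureSqInertialSource (u t)) with hGB
  have hGAs : Torus.IsSmooth GA := Torus.isSmooth_invLaplacian hA
  have hGBs : Torus.IsSmooth GB := Torus.isSmooth_invLaplacian hB
  have hWeq : W = ν • GA + GB := by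
    have e3 : W = Torus.invLaplacian
        (fun x => ν * pressureSqViscousSource (u t) x + pressureSqInertialSource (u t) x) := by
      funext x
      have e4 : Torus.timeDerivWithin (Icc a b) (fun s => pressureOf (u s)) t x =
          Torus.invLaplacian (Torus.timeDerivWithin (Icc a b) (fun s y => -gradSqTrace (u s) y) t) x :=
        Torus.timeDerivWithin_invLaplacian hab hσ ht x
      rw [hW, e4, timeDerivWithin_neg_gradSqTrace h hab ht]
    have e5 : (fun x => ν * pressureSqViscousSource (u t) x + pressureSqInertialSource (u t) x) =
        ν • pressureSqViscousSource (u t) + pressureSqInertialSource (u t) := by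
      funext x; simp [smul_eq_mul]
    rw [e3, e5, Torus.invLaplacian_add (hA.smul ν) hB, Torus.invLaplacian_const_smul ν _ hA]
  -- the time derivative of the gradient is the gradient of `W`
  have hDθ : ∀ x, Torus.timeDerivWithin (Icc a b) (fun s => Torus.gradient (pressureOf (u s))) t x =
      Torus.gradient W x := by
    intro x
    have h1 : ∀ j, HasDerivWithinAt (fun s => Torus.partialDeriv j (pressureOf (u s)) x)
        (Torus.partialDeriv j W x) (Icc a b) t := by
      intro j
      have h0 := (hP.partialDeriv hU j).hasDerivWithinAt_slice ht x
      rw [Torus.timeDerivWithin_partialDeriv_comm hab hP ht j x] at h0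
      exact h0
    have h2 : HasDerivWithinAt
        (fun s => ∑ j, Torus.partialDeriv j (pressureOf (u s)) x • EuclideanSpace.single j (1 : ℝ))
        (∑ j, Torus.partialDeriv j W x • EuclideanSpace.single j (1 : ℝ)) (Icc a b) t :=
      HasDerivWithinAt.fun_sum (u := Finset.univ) fun j _ => (h1 j).smul_const _
    have h3 : HasDerivWithinAt (fun s => Torus.gradient (pressureOf (u s)) x) (Torus.gradient W x)
        (Icc a b) t := by
      rw [Torus.gradient_eq_sum_partialDeriv (hWs.isContDiff (by simp))]
      refine h2.congr (fun s hs => ?_) ?_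
      · exact Torus.gradient_eq_sum_partialDeriv ((hπs s hs).isContDiff (by simp)) x
      · exact Torus.gradient_eq_sum_partialDeriv (hπ.isContDiff (by simp)) x
    rw [Torus.timeDerivWithin, h3.derivWithin (hU t ht)]
  have hgradW : ∀ x, Torus.gradient W x = ν • Torus.gradient GA x + Torus.gradient GB x := by
    intro x
    rw [hWeq]
    exact gradient_const_smul_add (hGAs.isContDiff (by simp)) (hGBs.isContDiff (by simp)) ν x
  -- differentiate under the integral with the `C¹` weight `‖·‖^q`
  have hΦ : ContDiff ℝ 1 (fun w : EuclideanSpace ℝ d => ‖w‖ ^ q) := contDiff_norm_rpow hq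
  have hD := C1Weight.hasDerivWithinAt_integral_comp_fderiv_of_contDiff hab hθ hΦ ht
  unfold torusGradPressureMoment
  refine hD.congr_deriv ?_
  -- continuity / integrability of the pieces, through the continuous `DΦ`
  have hcF : Continuous fun x => fderiv ℝ (fun w : EuclideanSpace ℝ d => ‖w‖ ^ q)
      (Torus.gradient (pressureOf (u t)) x) :=
    (hΦ.continuous_fderiv one_ne_zero).comp hπ.gradient.continuous
  have iA : Integrable fun x => fderiv ℝ (fun w : EuclideanSpace ℝ d => ‖w‖ ^ q)
      (Torus.gradient (pressureOf (u t)) x) (Torus.gradient GA x) :=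
    (hcF.clm_apply hGAs.gradient.continuous).integrable_unitAddTorus
  have iB : Integrable fun x => fderiv ℝ (fun w : EuclideanSpace ℝ d => ‖w‖ ^ q)
      (Torus.gradient (pressureOf (u t)) x) (Torus.gradient GB x) :=
    (hcF.clm_apply hGBs.gradient.continuous).integrable_unitAddTorus
  have e1 : ∀ x, fderiv ℝ (fun w : EuclideanSpace ℝ d => ‖w‖ ^ q) (Torus.gradient (pressureOf (u t)) x)
      (Torus.timeDerivWithin (Icc a b) (fun s => Torus.gradient (pressureOf (u s))) t x) =
      ν * fderiv ℝ (fun w : EuclideanSpace ℝ d => ‖w‖ ^ q) (Torus.gradient (pressureOf (u t)) x)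
          (Torus.gradient GA x) +
        fderiv ℝ (fun w : EuclideanSpace ℝ d => ‖w‖ ^ q) (Torus.gradient (pressureOf (u t)) x)
          (Torus.gradient GB x) := by
    intro x
    rw [hDθ x, hgradW x, map_add, map_smul, smul_eq_mul]
  simp_rw [e1]
  rw [integral_add (iA.const_mul ν) iB, integral_const_mul]
  simp_rw [fderiv_norm_rpow_apply' hq]
  rw [gradPressureRpowViscousRate, gradPressureRpowInertialRate, hGA, hGB]
  ring

/-- **The initial rates of the rows `EP.gradp.q`, real `q > 1`**:
`HasInitialRate (torusGradPressureMoment q) N_q V_q` on `T³`. [ours] -/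
theorem hasInitialRate_torusGradPressureMoment_rpow {q : ℝ} (hq : 1 < q) :
    HasInitialRate (d := d) (torusGradPressureMoment q) (gradPressureRpowInertialRate q)
      (gradPressureRpowViscousRate q) := by
  intro hd ν _ a b hab u p hsol _
  haveI : Nonempty d := Fintype.card_pos_iff.mp (by omega)
  exact hasDerivWithinAt_torusGradPressureMoment_rpow hq hsol hab (left_mem_Icc.2 hab.le)

end Summit.NavierStokesRegularity.FunctionalMining
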